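import Literature.NumberTheory.LFunctions.ThetaChainFreeCheck
import HarnessLib

/-!
# Schoenfeld's `θ`-bound on `[599, 10⁸]` by kernel computation: data-free run, chunk 27 of 35

Topic: `Literature/NumberTheory/LFunctions`. Pure proof file (a kernel computation; nothing is
asserted, no definition). The theorems below evaluate `ThetaChain.runFree` — together `150000`
data-free steps of the certified `θ`-chain (`ThetaChain.stepFree`, `ThetaChainFreeCheck.lean`: the
next prime found and certified by two gcds with the primorials of the odd primes `≤ 2999` and in
`(2999, 10007]`, the enclosures of `log p` and `θ(p)`, and the two comparisons behind
`|θ(x) − x| ≤ √x log² x/(8π)`) — from the state at the prime `76833401` to the state at the prime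
`79561711`. Soundness: `ThetaChain.runFree_sound`; assembly of the 35 chunks: `ThetaUpTo1e8.lean`.
The expected states were obtained by evaluating a twin of the same function outside the kernel
(validated bit-for-bit on the tree's chunk `ThetaChainRun.xrun14`). Declarations of `5·10⁴` steps
(about `70 s` of kernel time each; the kernel's evaluation is linear within a declaration of this size),
`decide +kernel`, standard axioms only (`maxHeartbeats 0` lifts the deterministic time-out).

## References

* L. Schoenfeld, *Sharper bounds for the Chebyshev functions θ(x) and ψ(x). II*, Math. Comp. 30
  (1976), 337–360, Thm. 10 (6.3). [Schoenfeld1976]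
* J. B. Rosser, L. Schoenfeld, *Approximate formulas for some functions of prime numbers*,
  Illinois J. Math. 6 (1962), 64–94, Thms. 18–19 (`θ`-tables to `10⁸`). [RosserSchoenfeld1962]
-/

namespace Literature.NumberTheory.LFunctions.ThetaChainRun

open ThetaChain

set_option maxHeartbeats 0 in
/-- **Data-free certified `θ`-run, chunk 27a** (steps `3900001`–`3950000` after `8886113`: 50000 primes,
`76833401` to `77741803`). [cite: Schoenfeld1976, Thm. 10 (6.3)] -/
theorem frun27a :
    runFree 50000
      ⟨76833401, 21950647460638393112180462, 21950647460638868807773079, 92875692145352187437893094188317, 92875692145354325656645321139676⟩ =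
    some ⟨77741803, 21964856767781242057219950, 21964856767781717753762797, 93973580189580615368662709928519, 93973580189582777372218323859118⟩ := by
  decide +kernel

set_option maxHeartbeats 0 in
/-- **Data-free certified `θ`-run, chunk 27b** (steps `3950001`–`4000000` after `8886113`: 50000 primes,
`77741803` to `78652297`). [cite: Schoenfeld1976, Thm. 10 (6.3)] -/
theorem frun27b :
    runFree 50000
      ⟨77741803, 21964856767781242057219950, 21964856767781717753762797, 93973580189580615368662709928519, 93973580189582777372218323859118⟩ =
    some ⟨78652297, 21978933157378033296048975, 21978933157378508993542027, 95072175359537790623306251840643, 95072175359539976411712763241012⟩ := by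
  decide +kernel

set_option maxHeartbeats 0 in
/-- **Data-free certified `θ`-run, chunk 27c** (steps `4000001`–`4050000` after `8886113`: 50000 primes,
`78652297` to `79561711`). [cite: Schoenfeld1976, Thm. 10 (6.3)] -/
theorem frun27c :
    runFree 50000
      ⟨78652297, 21978933157378033296048975, 21978933157378508993542027, 95072175359537790623306251840643, 95072175359539976411712763241012⟩ =
    some ⟨79561711, 21992831119859177331254625, 21992831119859653029697932, 96171470025493420169307583882691, 96171470025495629742612504537270⟩ := by
  decide +kernel

end Literature.NumberTheory.LFunctions.ThetaChainRun
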